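import Literature.NumberTheory.Irrationality.RivoalZudilin2020.PartialFractionsProofs
import HarnessLib

/-!
# Rivoal–Zudilin 2020, §3: the well-poised reflection of the `p_{j,m}` and the residue at infinity (proofs)

Topic `Literature/NumberTheory/Irrationality/RivoalZudilin2020`; proofs-only companion of
`TwoIrrationalOddZetaValues.lean` (no new definition, no new named fact), continuing `PartialFractionsProofs.lean`.
Source: T. Rivoal, W. Zudilin, *A note on odd zeta values*, Sém. Lothar. Combin. **81** (2020) B81b =
arXiv:1803.03160 [RivoalZudilin2020], proof of Proposition 1 (i) (§3): "Now, `−Σ_{m=0}^{n} p_{1,m}` is the residue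
at `t = ∞` of `R(t)`, hence is `0`. Moreover, we can use in (5) the symmetry `R(−n−t) = (−1)^{(A+1)(n+1)}R(t) = −R(t)`
(because `A` and `n` are even): it implies that `p_{j,m} = (−1)^{j+1}p_{j,n−m}`. Hence `Σ_{m=0}^{n} p_{j,m} = 0` when
`j` is even."  This file PROVES, for the typed `rfun`, `rfunReg`, `pCoeff`:

* `rfunReg_reflect` — for `A`, `n` even and `m ≤ n`, `rfunReg A n (n−m) (−n−t) = −rfunReg A n m t` for every real
  `t` (the printed symmetry multiplied through by `(t+m)^A = (−n−t+(n−m))^A`; an identity of the explicit products,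
  by reflecting the three Pochhammer blocks and the punctured denominator);
* `pCoeff_reflect` — `p_{j,n−m} = (−1)^{j+1} p_{j,m}` (`j ≤ A`), by translating and reflecting the divided
  derivative (`Literature.Analysis.Calculus.divDeriv_comp_add_const`, `divDeriv_comp_neg`), as in the tree's
  `Transcendental/ZudilinSymmetry.lean`; hence `sum_pCoeff_eq_zero_of_even` — `Σ_m p_{j,m} = 0` for even `j`;
* `tendsto_mul_rfun` — `t·R(t) → 0` as `t → +∞` ("the degree of `R(t)` is `(15−A)n−A+1 ≤ −2`"; here from
  `deg(t · numerator) ≤ 15n+2 < A(n+1)` and Mathlib's `Polynomial.div_tendsto_atTop_zero_of_degree_lt`), and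
  `sum_pCoeff_one_eq_zero` — the residues sum to zero, `Σ_m p_{1,m} = 0` (`A ≥ 15`), by comparing with
  `t · Σ_{m,j} p_{j,m}(t+m)^{−j} → Σ_m p_{1,m}`.

HONEST FRAMING (cells pub-zeta5 / zeta5-irr): systematic search; no irrationality claim unless certified — identities
of rational functions and of their Taylor coefficients; nothing about the arithmetic of any zeta value.
-/

noncomputable section

open Finset Filter Topology Polynomial
open Literature.Analysis.Calculus
open scoped Nat

namespace Literature.NumberTheory.Irrationality.RivoalZudilin2020

/-! ### The well-poised reflection `t ↦ −n − t` -/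

/-- `∏_{i<n} (−n−t−n+i) = (−1)^n ∏_{i<n} (t+n+1+i)`. [folklore] -/
private theorem prod_reflect_one (n : ℕ) (t : ℝ) :
    ∏ i ∈ range n, (-(n : ℝ) - t - n + i) = (-1) ^ n * ∏ i ∈ range n, (t + n + 1 + i) := by
  rw [← prod_range_reflect (fun i => (t + n + 1 + (i : ℝ))) n]
  have : ∏ i ∈ range n, (-(n : ℝ) - t - n + i) = ∏ i ∈ range n, -(t + n + 1 + ((n - 1 - i : ℕ) : ℝ)) := by
    refine prod_congr rfl fun i hi => ?_
    have hi' := mem_range.1 hi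
    rw [Nat.cast_sub (by omega), Nat.cast_sub (by omega)]
    push_cast
    ring
  rw [this, prod_neg, card_range]

/-- `∏_{i<n} (−n−t+n+1+i) = (−1)^n ∏_{i<n} (t−n+i)`. [folklore] -/
private theorem prod_reflect_two (n : ℕ) (t : ℝ) :
    ∏ i ∈ range n, (-(n : ℝ) - t + n + 1 + i) = (-1) ^ n * ∏ i ∈ range n, (t - n + i) := by
  rw [← prod_range_reflect (fun i => (t - n + (i : ℝ))) n]
  have : ∏ i ∈ range n, (-(n : ℝ) - t + n + 1 + i) = ∏ i ∈ range n, -(t - n + ((n - 1 - i : ℕ) : ℝ)) := by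
    refine prod_congr rfl fun i hi => ?_
    have hi' := mem_range.1 hi
    rw [Nat.cast_sub (by omega), Nat.cast_sub (by omega)]
    push_cast
    ring
  rw [this, prod_neg, card_range]

/-- `∏_{i<3n} (−n−t−n+½+i) = (−1)^{3n} ∏_{i<3n} (t−n+½+i)`. [folklore] -/
private theorem prod_reflect_three (n : ℕ) (t : ℝ) :
    ∏ i ∈ range (3 * n), (-(n : ℝ) - t - n + 1 / 2 + i) =
      (-1) ^ (3 * n) * ∏ i ∈ range (3 * n), (t - n + 1 / 2 + i) := by
  rw [← prod_range_reflect (fun i => (t - n + 1 / 2 + (i : ℝ))) (3 * n)]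
  have : ∏ i ∈ range (3 * n), (-(n : ℝ) - t - n + 1 / 2 + i) =
      ∏ i ∈ range (3 * n), -(t - n + 1 / 2 + ((3 * n - 1 - i : ℕ) : ℝ)) := by
    refine prod_congr rfl fun i hi => ?_
    have hi' := mem_range.1 hi
    rw [Nat.cast_sub (by omega), Nat.cast_sub (by omega)]
    push_cast
    ring
  rw [this, prod_neg, card_range]

/-- The denominators: for `A` even and `m ≤ n`,
`∏_{k ≤ n, k ≠ n−m} (−n−t+k)^A = ∏_{k ≤ n, k ≠ m} (t+k)^A`. [folklore] -/
private theorem prod_erase_reflect {A : ℕ} (hA : Even A) {n m : ℕ} (hm : m ≤ n) (t : ℝ) :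
    ∏ k ∈ (range (n + 1)).erase (n - m), (-(n : ℝ) - t + k) ^ A =
      ∏ k ∈ (range (n + 1)).erase m, (t + k) ^ A := by
  refine prod_nbij' (fun k => n - k) (fun k => n - k) ?_ ?_ ?_ ?_ ?_
  · intro k hk
    have := mem_erase.1 hk; have := mem_range.1 this.2
    exact mem_erase.2 ⟨by omega, mem_range.2 (by omega)⟩
  · intro k hk
    have := mem_erase.1 hk; have := mem_range.1 this.2
    exact mem_erase.2 ⟨by omega, mem_range.2 (by omega)⟩
  · intro k hk
    have := mem_erase.1 hk; have := mem_range.1 this.2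
    show n - (n - k) = k
    omega
  · intro k hk
    have := mem_erase.1 hk; have := mem_range.1 this.2
    show n - (n - k) = k
    omega
  · intro k hk
    have hk' := mem_range.1 (mem_erase.1 hk).2
    rw [Nat.cast_sub (by omega), show (-(n : ℝ) - t + k) = -(t + ((n : ℝ) - k)) by ring, hA.neg_pow]

/-- **Reflection of the regularised functions**: for `A` and `n` even and `m ≤ n`,
`rfunReg A n (n−m) (−n−t) = −rfunReg A n m t` for every real `t` (the printed
`R(−n−t) = (−1)^{(A+1)(n+1)} R(t) = −R(t)`, multiplied by `(t+m)^A = (−n−t+(n−m))^A`).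
[cite: RivoalZudilin2020, §3 proof of Proposition 1 (i) (the symmetry)] -/
theorem rfunReg_reflect {A n : ℕ} (hA : Even A) (hn : Even n) {m : ℕ} (hm : m ≤ n) (t : ℝ) :
    rfunReg A n (n - m) (-(n : ℝ) - t) = -rfunReg A n m t := by
  unfold rfunReg
  rw [prod_erase_reflect hA hm t, prod_reflect_one, prod_reflect_two, prod_reflect_three, ← neg_div]
  congr 1
  have h1 : ((-1 : ℝ) ^ n) = 1 := hn.neg_one_pow
  have h3 : ((-1 : ℝ) ^ (3 * n)) = 1 := by rw [pow_mul]; norm_num [h1]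
  rw [h1, h3]
  ring

/-- `rfunReg A n (n−m)` is the reflected germ `t ↦ −rfunReg A n m (−n−t)` (as functions on `ℝ`).
[cite: RivoalZudilin2020, §3 proof of Proposition 1 (i) (the symmetry)] -/
theorem rfunReg_sub_eq {A n : ℕ} (hA : Even A) (hn : Even n) {m : ℕ} (hm : m ≤ n) :
    rfunReg A n (n - m) = fun t => -rfunReg A n m (-(n : ℝ) - t) := by
  funext t
  have h := rfunReg_reflect hA hn hm (-(n : ℝ) - t)
  rw [show (-(n : ℝ) - (-(n : ℝ) - t)) = t by ring] at h
  rw [h]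

/-- **Well-poised symmetry of the Taylor coefficients**: for `A` and `n` even, `m ≤ n`, `j ≤ A`,
`p_{j,n−m} = (−1)^{j+1} p_{j,m}`. [cite: RivoalZudilin2020, §3 proof of Proposition 1 (i)] -/
theorem pCoeff_reflect {A n : ℕ} (hA : Even A) (hn : Even n) {m : ℕ} (hm : m ≤ n) {j : ℕ} (hj : j ≤ A) :
    pCoeff A n j (n - m) = (-1) ^ (j + 1) * pCoeff A n j m := by
  rw [pCoeff_eq_divDeriv, pCoeff_eq_divDeriv, rfunReg_sub_eq hA hn hm, divDeriv_neg]
  have hfun : (fun t : ℝ => rfunReg A n m (-(n : ℝ) - t))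
      = fun t => (fun u => rfunReg A n m (-u)) (t + (n : ℝ)) := by
    funext t; simp only; congr 1; ring
  rw [hfun, show divDeriv (A - j) (fun t => (fun u => rfunReg A n m (-u)) (t + (n : ℝ))) (-((n - m : ℕ) : ℝ))
      = divDeriv (A - j) (fun u => rfunReg A n m (-u)) (-((n - m : ℕ) : ℝ) + (n : ℝ)) from
      divDeriv_comp_add_const (A - j) (fun u => rfunReg A n m (-u)) (n : ℝ) (-((n - m : ℕ) : ℝ)),
    divDeriv_comp_neg]
  have hpt : -(-((n - m : ℕ) : ℝ) + (n : ℝ)) = -(m : ℝ) := by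
    rw [Nat.cast_sub hm]; ring
  rw [hpt]
  have hsign : -((-1 : ℝ) ^ (A - j)) = (-1) ^ (j + 1) := by
    rw [neg_eq_neg_one_mul, ← pow_succ', neg_one_pow_eq_pow_mod_two,
      neg_one_pow_eq_pow_mod_two (R := ℝ) (n := j + 1)]
    congr 1
    obtain ⟨a, ha⟩ := hA
    omega
  rw [← neg_mul, hsign]

/-- The reflection `m ↦ n − m` of the pole indices. [folklore] -/
private theorem reflect_mem_range {n m : ℕ} (hm : m ∈ range (n + 1)) : n - m ∈ range (n + 1) := by
  have := mem_range.1 hm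
  exact mem_range.2 (by omega)

/-- **The coefficients of the even zeta values vanish**: `Σ_{m=0}^{n} p_{j,m} = 0` for `A`, `n`, `j` even,
`j ≤ A`. [cite: RivoalZudilin2020, §3 proof of Proposition 1 (i)] -/
theorem sum_pCoeff_eq_zero_of_even {A n : ℕ} (hA : Even A) (hn : Even n) {j : ℕ} (hj : j ≤ A)
    (hje : Even j) : ∑ m ∈ range (n + 1), pCoeff A n j m = 0 := by
  have hrefl : ∑ m ∈ range (n + 1), pCoeff A n j m = ∑ m ∈ range (n + 1), pCoeff A n j (n - m) := by
    refine sum_nbij' (fun m => n - m) (fun m => n - m) ?_ ?_ ?_ ?_ ?_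
    · intro m hm; exact reflect_mem_range hm
    · intro m hm; exact reflect_mem_range hm
    · intro m hm; have := mem_range.1 hm; show n - (n - m) = m; omega
    · intro m hm; have := mem_range.1 hm; show n - (n - m) = m; omega
    · intro m hm
      have := mem_range.1 hm
      rw [show n - (n - m) = m by omega]
  have hneg : ∑ m ∈ range (n + 1), pCoeff A n j (n - m) = -∑ m ∈ range (n + 1), pCoeff A n j m := by
    rw [← sum_neg_distrib]
    refine sum_congr rfl fun m hm => ?_
    rw [pCoeff_reflect hA hn (by have := mem_range.1 hm; omega) hj, pow_succ, hje.neg_one_pow]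
    ring
  linarith [hrefl.trans hneg]

/-! ### The residue at infinity -/

/-- `t (t+i)^{−s} → [s = 1]` as `t → ∞` (`1 ≤ s ≤ A`). [folklore] -/
private theorem tendsto_mul_inv_pow' (i : ℕ) {A s : ℕ} (hs : s ∈ Icc 1 A) :
    Tendsto (fun t : ℝ => t * ((t + i) ^ s)⁻¹) atTop (𝓝 (if s = 1 then 1 else 0)) := by
  have hs1 : 1 ≤ s := (mem_Icc.1 hs).1
  -- `t/(t+i) → 1`
  have h1 : Tendsto (fun t : ℝ => t * (t + i)⁻¹) atTop (𝓝 1) := by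
    have h : Tendsto (fun t : ℝ => 1 - (i : ℝ) * (t + i)⁻¹) atTop (𝓝 (1 - 0)) := by
      refine tendsto_const_nhds.sub ?_
      have := (tendsto_const_nhds (x := (i : ℝ))).div_atTop
        (tendsto_atTop_add_const_right atTop (i : ℝ) tendsto_id)
      simpa [div_eq_mul_inv] using this
    rw [sub_zero] at h
    refine h.congr' ?_
    filter_upwards [eventually_gt_atTop 0] with t ht
    have : (t + i : ℝ) ≠ 0 := by positivity
    field_simp
    ring
  rcases hs1.eq_or_lt with rfl | hs'
  · simpa using h1
  · rw [if_neg (by omega)]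
    have h2 : Tendsto (fun t : ℝ => ((t + i) ^ (s - 1))⁻¹) atTop (𝓝 0) :=
      ((tendsto_pow_atTop (by omega : s - 1 ≠ 0)).comp
        (tendsto_atTop_add_const_right atTop (i : ℝ) tendsto_id)).inv_tendsto_atTop
    have := h1.mul h2
    rw [one_mul] at this
    refine this.congr' ?_
    filter_upwards [eventually_gt_atTop 0] with t ht
    have : (t + i : ℝ) ≠ 0 := by positivity
    have hs2 : (t + i : ℝ) ^ s = (t + i) ^ (s - 1) * (t + i) := by
      rw [← pow_succ]; congr 1; omega
    rw [hs2, mul_inv]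
    ring

/-- `t·R(t) → 0` as `t → +∞` ("the degree of `R(t)` is `(15−A)n − A + 1 ≤ −2`"), for `A ≥ 15`.
[cite: RivoalZudilin2020, §2 (degree of R)] -/
theorem tendsto_mul_rfun (A n : ℕ) (hA : 15 ≤ A) : Tendsto (fun t : ℝ => t * rfun A n t) atTop (𝓝 0) := by
  classical
  set P : ℝ[X] := X * (C ((n ! : ℝ) ^ (A - 15) * 2 ^ (18 * n)) * (C 2 * X + C (n : ℝ)) *
      ((∏ i ∈ range n, (X + C ((i : ℝ) - n))) ^ 3 * (∏ i ∈ range n, (X + C ((n : ℝ) + 1 + i))) ^ 3 *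
        (∏ i ∈ range (3 * n), (X + C ((i : ℝ) - n + 1 / 2))) ^ 3)) with hP
  set Q : ℝ[X] := ∏ k ∈ range (n + 1), (X + C (k : ℝ)) ^ A with hQ
  have hlin : ∀ u : ℝ, (X + C u : ℝ[X]).natDegree ≤ 1 := fun u => (natDegree_X_add_C u).le
  have hprod : ∀ (k : ℕ) (u : ℕ → ℝ), (∏ i ∈ range k, (X + C (u i) : ℝ[X])).natDegree ≤ k := by
    intro k u
    refine (natDegree_prod_le _ _).trans ?_
    refine (sum_le_sum (g := fun _ => 1) fun i _ => hlin _).trans ?_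
    simp
  have hdegP : P.natDegree ≤ 15 * n + 2 := by
    have h0 : (C ((n ! : ℝ) ^ (A - 15) * 2 ^ (18 * n)) * (C 2 * X + C (n : ℝ)) : ℝ[X]).natDegree ≤ 1 :=
      (natDegree_C_mul_le _ _).trans natDegree_linear_le
    have h1 := (natDegree_pow_le (p := ∏ i ∈ range n, (X + C ((i : ℝ) - n))) (n := 3)).trans
      (Nat.mul_le_mul_left 3 (hprod n fun i => (i : ℝ) - n))
    have h2 := (natDegree_pow_le (p := ∏ i ∈ range n, (X + C ((n : ℝ) + 1 + i))) (n := 3)).trans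
      (Nat.mul_le_mul_left 3 (hprod n fun i => (n : ℝ) + 1 + i))
    have h3 := (natDegree_pow_le (p := ∏ i ∈ range (3 * n), (X + C ((i : ℝ) - n + 1 / 2))) (n := 3)).trans
      (Nat.mul_le_mul_left 3 (hprod (3 * n) fun i => (i : ℝ) - n + 1 / 2))
    have h123 := natDegree_mul_le.trans (add_le_add (natDegree_mul_le.trans (add_le_add h1 h2)) h3)
    have hX : (X : ℝ[X]).natDegree ≤ 1 := natDegree_X_le
    refine (natDegree_mul_le.trans (add_le_add hX (natDegree_mul_le.trans (add_le_add h0 h123)))).trans ?_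
    omega
  have hdegQ : Q.natDegree = (n + 1) * A := by
    rw [hQ, natDegree_prod_of_monic (range (n + 1)) (fun k : ℕ => (X + C (k : ℝ)) ^ A)
      fun k _ => (monic_X_add_C (k : ℝ)).pow A]
    simp only [natDegree_pow, natDegree_X_add_C, mul_one, sum_const, card_range, smul_eq_mul]
  have hdeg : P.degree < Q.degree := by
    refine degree_lt_degree ?_
    rw [hdegQ]
    have : 15 * n + 2 < (n + 1) * A := by nlinarith
    omega
  have hlim := Polynomial.div_tendsto_atTop_zero_of_degree_lt P Q hdeg
  refine hlim.congr' ?_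
  filter_upwards [eventually_gt_atTop 0] with t ht
  rw [hP, hQ, rfun]
  simp only [eval_mul, eval_C, eval_add, eval_X, eval_pow, eval_prod]
  have e1 : ∏ i ∈ range n, (t + ((i : ℝ) - n)) = ∏ i ∈ range n, (t - n + i) :=
    prod_congr rfl fun i _ => by ring
  have e2 : ∏ i ∈ range (3 * n), (t + ((i : ℝ) - n + 1 / 2)) = ∏ i ∈ range (3 * n), (t - n + 1 / 2 + i) :=
    prod_congr rfl fun i _ => by ring
  have e3 : ∏ i ∈ range n, (t + ((n : ℝ) + 1 + i)) = ∏ i ∈ range n, (t + n + 1 + i) :=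
    prod_congr rfl fun i _ => by ring
  rw [e1, e2, e3]
  ring

/-- `t · Σ_{m,j} p_{j,m}(t+m)^{−j} → Σ_m p_{1,m}` as `t → +∞`. [folklore] -/
private theorem tendsto_mul_sum_pCoeff (A n : ℕ) (hA : 15 ≤ A) :
    Tendsto (fun t : ℝ => t * ∑ m ∈ range (n + 1), ∑ j ∈ Icc 1 A, pCoeff A n j m * ((t + m) ^ j)⁻¹)
      atTop (𝓝 (∑ m ∈ range (n + 1), pCoeff A n 1 m)) := by
  have h : Tendsto (fun t : ℝ => ∑ m ∈ range (n + 1), ∑ j ∈ Icc 1 A, pCoeff A n j m * (t * ((t + m) ^ j)⁻¹))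
      atTop (𝓝 (∑ m ∈ range (n + 1), ∑ j ∈ Icc 1 A, pCoeff A n j m * (if j = 1 then 1 else 0))) := by
    refine tendsto_finsetSum _ fun m _ => tendsto_finsetSum _ fun j hj => ?_
    exact (tendsto_mul_inv_pow' m hj).const_mul _
  have hval : ∑ m ∈ range (n + 1), ∑ j ∈ Icc 1 A, pCoeff A n j m * (if j = 1 then (1 : ℝ) else 0)
      = ∑ m ∈ range (n + 1), pCoeff A n 1 m := by
    refine sum_congr rfl fun m _ => ?_
    simp only [mul_ite, mul_one, mul_zero]
    rw [sum_ite_eq']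
    rw [if_pos (mem_Icc.2 ⟨le_rfl, by omega⟩)]
  rw [hval] at h
  refine h.congr fun t => ?_
  simp only [mul_sum]
  exact sum_congr rfl fun m _ => sum_congr rfl fun j _ => by ring

/-- **The residues sum to zero**: `Σ_{m=0}^{n} p_{1,m} = 0` for `A ≥ 15` ("`−Σ_m p_{1,m}` is the residue at
`t = ∞` of `R(t)`, hence is `0`"), so `ζ(3)` does not occur in `S_n`.
[cite: RivoalZudilin2020, §3 proof of Proposition 1 (i)] -/
theorem sum_pCoeff_one_eq_zero (A n : ℕ) (hA : 15 ≤ A) : ∑ m ∈ range (n + 1), pCoeff A n 1 m = 0 := by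
  have h1 := tendsto_mul_rfun A n hA
  have h2 := tendsto_mul_sum_pCoeff A n hA
  have heq : (fun t : ℝ => t * rfun A n t)
      =ᶠ[atTop] fun t => t * ∑ m ∈ range (n + 1), ∑ j ∈ Icc 1 A, pCoeff A n j m * ((t + m) ^ j)⁻¹ := by
    filter_upwards [eventually_gt_atTop 0] with t ht
    rw [rfun_eq_sum_pCoeff A n hA fun i _ => by positivity]
  exact (tendsto_nhds_unique (h1.congr' heq) h2).symm

end Literature.NumberTheory.Irrationality.RivoalZudilin2020
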